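import Literature.MathematicalPhysics.QuantumLattice.LTQO
import Literature.MathematicalPhysics.QuantumLattice.LatticeToriProofs
import Literature.MathematicalPhysics.QuantumLattice.LocalDynamics
import HarnessLib

/-!
# Families of quasi-local pieces as interactions; counting on decorated tori

Seventeenth file of the formalisation of the Michalakis–Zwolak stability theorem (hubbard.S19):
bookkeeping between the site-and-radius indexed decompositions of MZ13 §5
(`𝓕(O_u(r)) = Σ_{r'} 𝓕(r'; O_u(r))`, `D(s) = Σ_u Σ_{r} D_u(r, s)`, …) and the region-indexed
`Interaction`s of the Lieb–Robinson files (`FlowLiebRobinsonProofs`, `FlowQuasiLocalityProofs`):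

* `isLocal_reindex`, `exists_eq_of_reindex_ne_zero` — grouping a finite family of local Hermitian
  pieces `P i ∈ 𝔄_{S i}` by support gives a local interaction (its total is the sum of the family
  by Mathlib's `Finset.sum_fiberwise`);
* `sum_norm_reindex_le`, `sum_norm_reindex_not_le` — its local norms `Σ_{Z ∋ x} ‖Ψ Z‖` (all
  terms, and the long-range terms singled out by a predicate) are bounded by the corresponding
  sums over the family;
* `card_filter_torusNorm_le`, `card_torusBall_le`, `card_cellBall_le` — balls of the decorated
  torus `(ℤ/L)^d × κ` have at most `(2r+1)^d |κ|` points, uniformly in `L`;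
  `card_filter_mem_cellBall_le` — at most `(2R+1)^d` centres have a ball containing a given
  point; `sum_norm_pieces_le` — hence pieces on the balls `b_u(r+k)` with `‖P(u,k)‖ ≤ G k` have
  local norm `≤ Σ_k (2(r+k)+1)^d G k`, uniformly in the volume (MZ13 §5, the sums over `u`).

No definitions, no named facts (theorems only). [folklore]
-/

noncomputable section

open Finset
open scoped Matrix.Norms.L2Operator

namespace Literature.MathematicalPhysics.QuantumLattice

/-! ### Re-indexing a family of local terms by their supports -/

section Reindex

variable {Λ : Type*} [Fintype Λ] [DecidableEq Λ] {q : ℕ} {ι : Type*} [Fintype ι]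

/-- Grouping a finite family of local terms `P i`, supported on `S i`, by support gives a local
interaction `Z ↦ Σ_{S i = Z} P i`. [folklore] -/
theorem isLocal_reindex (S : ι → Finset Λ) {P : ι → Op Λ q} (hP : ∀ i, IsSupportedOn (P i) (S i))
    (hPh : ∀ i, (P i).IsHermitian) :
    Interaction.IsLocal (fun Z : Finset Λ => ∑ i ∈ univ.filter (fun i => S i = Z), P i) := by
  intro Z
  refine ⟨IsSupportedOn.sum _ fun i hi => ?_, ?_⟩
  · simp only [mem_filter, mem_univ, true_and] at hi
    rw [← hi]; exact hP i
  · rw [Matrix.IsHermitian, Matrix.conjTranspose_sum]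
    exact sum_congr rfl fun i _ => (hPh i).eq

omit [Fintype Λ] in
/-- A non-zero grouped term is the support of some member of the family. [folklore] -/
theorem exists_eq_of_reindex_ne_zero (S : ι → Finset Λ) (P : ι → Op Λ q) {Z : Finset Λ}
    (hZ : ∑ i ∈ univ.filter (fun i => S i = Z), P i ≠ 0) : ∃ i, S i = Z := by
  by_contra h
  have h' : ∀ i, S i ≠ Z := fun i hi => h ⟨i, hi⟩
  have : univ.filter (fun i => S i = Z) = ∅ := by
    ext i; simp [h' i]
  rw [this, sum_empty] at hZ
  exact hZ rfl

/-- **Local norm of the grouped interaction**: `Σ_{Z ∋ x} ‖Σ_{S i = Z} P i‖ ≤ Σ_{i : x ∈ S i} ‖P i‖`.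
[folklore] -/
theorem sum_norm_reindex_le (S : ι → Finset Λ) (P : ι → Op Λ q) (x : Λ) :
    ∑ Z ∈ univ.filter (fun Z : Finset Λ => x ∈ Z), ‖∑ i ∈ univ.filter (fun i => S i = Z), P i‖ ≤
      ∑ i ∈ univ.filter (fun i => x ∈ S i), ‖P i‖ := by
  calc ∑ Z ∈ univ.filter (fun Z : Finset Λ => x ∈ Z), ‖∑ i ∈ univ.filter (fun i => S i = Z), P i‖
      ≤ ∑ Z ∈ univ.filter (fun Z : Finset Λ => x ∈ Z), ∑ i ∈ univ.filter (fun i => S i = Z), ‖P i‖ :=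
        sum_le_sum fun Z _ => norm_sum_le _ _
    _ = ∑ i ∈ univ.filter (fun i => x ∈ S i), ‖P i‖ := by
        rw [← sum_fiberwise_of_maps_to (g := S) (s := univ.filter (fun i => x ∈ S i))
          (t := univ.filter (fun Z : Finset Λ => x ∈ Z)) (fun i hi => by
            simp only [mem_filter, mem_univ, true_and] at hi ⊢; exact hi)]
        refine sum_congr rfl fun Z hZ => sum_congr ?_ fun _ _ => rfl
        ext i
        simp only [mem_filter, mem_univ, true_and]
        simp only [mem_filter, mem_univ, true_and] at hZ
        constructor
        · intro h; exact ⟨by rw [h]; exact hZ, h⟩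
        · intro h; exact h.2

/-- **Local norm of the long-range part of the grouped interaction**: for a predicate `R` on
regions, `Σ_{Z ∋ x} ‖𝟙[¬R Z] Σ_{S i = Z} P i‖ ≤ Σ_{i : x ∈ S i, ¬R (S i)} ‖P i‖`. [folklore] -/
theorem sum_norm_reindex_not_le (S : ι → Finset Λ) (P : ι → Op Λ q) (x : Λ)
    (R : Finset Λ → Prop) [DecidablePred R] :
    ∑ Z ∈ univ.filter (fun Z : Finset Λ => x ∈ Z),
        ‖(if R Z then (0 : Op Λ q) else ∑ i ∈ univ.filter (fun i => S i = Z), P i)‖ ≤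
      ∑ i ∈ univ.filter (fun i => x ∈ S i ∧ ¬ R (S i)), ‖P i‖ := by
  -- replace `P` by its long-range part and use the previous lemma
  have h := sum_norm_reindex_le S (fun i => if R (S i) then (0 : Op Λ q) else P i) x
  have hL : ∀ Z : Finset Λ, (if R Z then (0 : Op Λ q) else ∑ i ∈ univ.filter (fun i => S i = Z), P i) =
      ∑ i ∈ univ.filter (fun i => S i = Z), (if R (S i) then (0 : Op Λ q) else P i) := by
    intro Z
    by_cases hR : R Z
    · rw [if_pos hR]
      symm
      refine sum_eq_zero fun i hi => ?_
      simp only [mem_filter, mem_univ, true_and] at hi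
      rw [hi, if_pos hR]
    · rw [if_neg hR]
      refine sum_congr rfl fun i hi => ?_
      simp only [mem_filter, mem_univ, true_and] at hi
      rw [hi, if_neg hR]
  have hR' : ∑ i ∈ univ.filter (fun i => x ∈ S i), ‖(if R (S i) then (0 : Op Λ q) else P i)‖ =
      ∑ i ∈ univ.filter (fun i => x ∈ S i ∧ ¬ R (S i)), ‖P i‖ := by
    rw [← sum_filter_add_sum_filter_not (univ.filter fun i => x ∈ S i) (fun i => R (S i))]
    have h0 : ∑ i ∈ (univ.filter fun i => x ∈ S i).filter (fun i => R (S i)),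
        ‖(if R (S i) then (0 : Op Λ q) else P i)‖ = 0 := by
      refine sum_eq_zero fun i hi => ?_
      simp only [mem_filter, mem_univ, true_and] at hi
      rw [if_pos hi.2, norm_zero]
    rw [h0, zero_add, filter_filter]
    refine sum_congr rfl fun i hi => ?_
    simp only [mem_filter, mem_univ, true_and] at hi
    rw [if_neg hi.2]
  simp only [hL]
  rw [← hR']
  exact h

end Reindex

/-! ### Counting centres on the decorated torus -/

section Torus

open Literature.Probability.LatticeModels

variable {d L : ℕ} [NeZero L] {κ : Type*} [Fintype κ] [DecidableEq κ] {q : ℕ}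

/-- The sublevel set of the torus norm sits in the product of the coordinate sublevel sets.
[folklore] -/
theorem filter_torusNorm_le_subset_piFinset (r : ℕ) :
    (univ.filter fun z : TorusSite d L => torusNorm z ≤ r) ⊆
      Fintype.piFinset fun _ : Fin d => univ.filter fun c : ZMod L => min c.val (L - c.val) ≤ r := by
  intro z hz
  simp only [mem_filter, mem_univ, true_and] at hz
  rw [Fintype.mem_piFinset]
  intro i
  simp only [mem_filter, mem_univ, true_and]
  exact (Finset.le_sup (f := fun i : Fin d => min (z i).val (L - (z i).val)) (mem_univ i)).trans hz

/-- **Balls of the torus norm have at most `(2r+1)^d` points**, uniformly in `L`. [folklore] -/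
theorem card_filter_torusNorm_le (r : ℕ) :
    #(univ.filter fun z : TorusSite d L => torusNorm z ≤ r) ≤ (2 * r + 1) ^ d := by
  refine (card_le_card (filter_torusNorm_le_subset_piFinset r)).trans ?_
  rw [Fintype.card_piFinset, prod_const, card_univ, Fintype.card_fin]
  exact Nat.pow_le_pow_left (card_filter_cyclicAbs_le_le r) d

/-- **Torus balls have at most `(2r+1)^d` points** (translate to the origin). [folklore] -/
theorem card_torusBall_le (x : TorusSite d L) (r : ℕ) : #(torusBall x r) ≤ (2 * r + 1) ^ d := by
  have h : torusBall x r = (univ.filter fun z : TorusSite d L => torusNorm z ≤ r).image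
      fun z => x - z := by
    ext y
    simp only [mem_torusBall_iff, mem_image, mem_filter, mem_univ, true_and, torusDist]
    constructor
    · intro hy
      exact ⟨x - y, hy, sub_sub_cancel x y⟩
    · rintro ⟨z, hz, rfl⟩
      rwa [sub_sub_cancel]
  rw [h]
  exact card_image_le.trans (card_filter_torusNorm_le r)

omit [DecidableEq κ] in
/-- **Cell balls of the decorated torus have at most `(2r+1)^d · |κ|` points**, uniformly in the
volume (the input `N_r` of `exists_norm_smoothing_sub_twirl_le_div_pow`). MZ13 §2. [folklore] -/
theorem card_cellBall_le (x : TorusSite d L) (r : ℕ) :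
    #(cellBall x r : Finset (TorusSite d L × κ)) ≤ (2 * r + 1) ^ d * Fintype.card κ := by
  rw [cellBall, card_product, card_univ]
  exact Nat.mul_le_mul_right _ (card_torusBall_le x r)

/-- **The number of centres whose ball contains a given point** is at most `(2R+1)^d`.
[folklore] -/
theorem card_filter_mem_cellBall_le (y : TorusSite d L × κ) (R : ℕ) :
    #(univ.filter fun u : TorusSite d L => y ∈ (cellBall u R : Finset (TorusSite d L × κ))) ≤
      (2 * R + 1) ^ d := by
  have h : (univ.filter fun u : TorusSite d L => y ∈ (cellBall u R : Finset (TorusSite d L × κ))) =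
      torusBall y.1 R := by
    ext u
    simp only [mem_filter, mem_univ, true_and, mem_cellBall_iff, mem_torusBall_iff]
    rw [torusDist_comm_holds]
  rw [h]
  exact card_torusBall_le y.1 R

/-- **Uniform local norm of a family of quasi-local pieces on the torus.** For pieces `P (u, k)`
supported on the balls `b_u(r + k)`, `k ≤ M`, with `‖P (u, k)‖ ≤ G k`:
`Σ_{(u,k) : y ∈ b_u(r+k)} ‖P (u,k)‖ ≤ Σ_{k ≤ M} (2(r+k)+1)^d G k` for every point `y`
(uniformly in the volume). MZ13 §5 (the sums over `u` in Lemmas 1, 2, 4). [folklore] -/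
theorem sum_norm_pieces_le (r M : ℕ) (P : TorusSite d L × Fin (M + 1) → Op (TorusSite d L × κ) q)
    {G : ℕ → ℝ} (hG0 : ∀ k, 0 ≤ G k) (hP : ∀ u k, ‖P (u, k)‖ ≤ G k) (y : TorusSite d L × κ)
    (Rk : Fin (M + 1) → Prop) [DecidablePred Rk] :
    ∑ i ∈ univ.filter (fun i : TorusSite d L × Fin (M + 1) =>
        y ∈ (cellBall i.1 (r + i.2) : Finset (TorusSite d L × κ)) ∧ Rk i.2), ‖P i‖ ≤
      ∑ k : Fin (M + 1), if Rk k then ((2 * (r + k) + 1) ^ d : ℕ) * G k else 0 := by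
  classical
  rw [sum_filter, Fintype.sum_prod_type, sum_comm]
  refine sum_le_sum fun k _ => ?_
  by_cases hk : Rk k
  · rw [if_pos hk]
    calc ∑ u : TorusSite d L, (if y ∈ (cellBall u (r + k) : Finset (TorusSite d L × κ)) ∧ Rk k
          then ‖P (u, k)‖ else 0)
        ≤ ∑ u : TorusSite d L, (if y ∈ (cellBall u (r + k) : Finset (TorusSite d L × κ))
          then G k else 0) := by
          refine sum_le_sum fun u _ => ?_
          by_cases hu : y ∈ (cellBall u (r + k) : Finset (TorusSite d L × κ))
          · rw [if_pos ⟨hu, hk⟩, if_pos hu]; exact hP u k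
          · rw [if_neg (fun h => hu h.1), if_neg hu]
      _ = #(univ.filter fun u : TorusSite d L => y ∈ (cellBall u (r + k) : Finset (TorusSite d L × κ)))
          * G k := by rw [← sum_filter, sum_const, nsmul_eq_mul]
      _ ≤ ((2 * (r + k) + 1) ^ d : ℕ) * G k := by
          refine mul_le_mul_of_nonneg_right ?_ (hG0 k)
          exact_mod_cast card_filter_mem_cellBall_le y (r + k)
  · rw [if_neg hk]
    refine le_of_eq (sum_eq_zero fun u _ => ?_)
    rw [if_neg (fun h => hk h.2)]

end Torus

end Literature.MathematicalPhysics.QuantumLattice
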